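import Summits.FinalStateConjecture.FinalStateConjecture.Theses.RootDecompCausalCells

/-!
# `RootDecompCausalCells.DispersiveExitGlue` (stmt-FinalStateConjecture-29360) — proof

Stand-alone proof (imports only the route file) of the GLUE support item of the gen-1 split of
`RootDecompCausalCells.DispersiveExit` (stmt-FinalStateConjecture-24766) into its three cells
`StationaryDispersiveExit` (σ, stmt-29357), `BreatherDispersiveExit` (β, stmt-29358) and
`DynamicalDispersiveExit` (δ, stmt-29359): children ⟹ parent. Filed by a prover seat of the decomp-fsc
cell (census seat, generation 23); the in-HOME kernel version is `FrameCarve.dispersiveExit_of_born_cells`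
(decomp-fsc lens-2 g20/g21, cell currency, gate audit proof-of-item), re-proved here directly on the tree
decls without the lens's cell vocabulary.

Statement (the tree decl, BY NAME): `StationaryDispersiveExit → BreatherDispersiveExit →
DynamicalDispersiveExit → DispersiveExit`.

Proof: the four decls share the same `let`-bound predicates `P` (the summit property of a datum),
`Disp` (dispersive type), `GStat` (a global stationary Killing field on some MGHD) and `Per` (a strictly
future-moving time-orientation-preserving isometry of some MGHD); the parent asks for a tame admissible
exit through `P` at every admissible `P`-exceptional datum of dispersive type, the children ask for it
on the sub-populations `Disp ∧ GStat`, `Disp ∧ ¬GStat ∧ Per`, `Disp ∧ ¬GStat ∧ ¬Per`, which exhaust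
`Disp` by excluded middle (twice). Pure logic; no geometry is used.
-/

-- D-0017: single-problem summit, `Summit.<S>.<S>.…` by design (cf. lakefile `weak.linter.dupNamespace`).
set_option linter.dupNamespace false

namespace Summit.FinalStateConjecture.FinalStateConjecture.Theorems.RootDecompCausalCellsDispersiveExitGlue

/-- **Glue of the dispersive column** (stmt-FinalStateConjecture-29360, BY NAME): if the stationary,
breather and dynamical dispersive cells each admit tame admissible exits through the summit property,
then so does the whole dispersive cell — the three cells exhaust it by excluded middle on «some MGHD
carries a global stationary Killing field» and then on «some MGHD carries a strictly future-moving
time-orientation-preserving isometry». -/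
theorem dispersiveExitGlue : Theses.RootDecompCausalCells.DispersiveExitGlue := by
  intro hσ hβ hδ X _ _ _ _ _ _
  have hσ' := hσ X
  have hβ' := hβ X
  have hδ' := hδ X
  dsimp only at hσ' hβ' hδ' ⊢
  intro d hd hnP hD
  exact (Classical.em _).elim (fun hG ↦ hσ' d hd hnP ⟨hD, hG⟩) fun hG ↦
    (Classical.em _).elim (fun hP ↦ hβ' d hd hnP ⟨hD, hG, hP⟩) fun hP ↦ hδ' d hd hnP ⟨hD, hG, hP⟩

end Summit.FinalStateConjecture.FinalStateConjecture.Theorems.RootDecompCausalCellsDispersiveExitGlue
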